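import Summits.AnomalousDissipation.AnomalousDissipation.Theses.TaylorCertificates

/-!
# Sketch — crux-ideate round 1, ideator 3, crux `TaylorCertificates.KolmogorovFloor`
(stmt-AnomalousDissipation-14030) — the DRESSED LAMINAR RAY (negative lever)

Companion of the memo `DRESSED-RAY-r1-3.md` and the idea card `idea-dressed-laminar-ray.md` (this seat).
Everything here is typed against the LIVE route file (rev 9); the logic lemmas are PROVED, the two analytic
statements of the line (`DressedRayKill`, `LinearResponseLemma`) are stated as `Prop`s with paper proofs in the
memo (§§2–4) and exact numerics (kit j009499).

* `FloorClassAtFor β f`   — the band-limited floor clause of resolution exponent `β` for ONE force `f`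
                             (the body of `KolmogorovFloor` with `3/4 ↦ β`); `kolmogorovFloor_iff` (rfl).
* `FloorKillAtFor β f`    — its `∀∃` negation shape (quantifier order of the crux);
                             `not_floorClassAtFor_of_kill`, `not_kolmogorovFloor_of_kill` (PROVED).
* `IsEulerShear U`        — a smooth STEADY EULER SHEAR skeleton: div-free mean-zero trig polynomial with
                             `(U·∇)U = 0` pointwise (`U = sin(2π ξ·x) ê`, `ξ ⊥ e` lattice vectors).
* `ApproxLinearResponse f U` — FIRST LEMMA object: band-limited approximate solutions `b_K` (degree `≤ K`) of the
                             LINEARISED steady Euler equation `(U·∇)b + (b·∇)U + ∇q = f`, with the bounds the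
                             kill consumes: energy `O(1)`, weighted-ℓ¹ slope `Σ_{|k|≤K}|k|‖b̂_K(k)‖ = O(K)`,
                             enstrophy `O(K)`, defect `|(L_U b_K − f, W)| ≤ (C/K)·max_k |k|‖Ŵ(k)‖` and self-advection
                             `|((b_K·∇)b_K, W)| ≤ C(1 + log K)·max_k |k|‖Ŵ(k)‖` for band-limited solenoidal `W`.
                             (Supplied per Fourier mode-line by the inhomogeneous RAYLEIGH equation at `c = 0`,
                             log-singular at the two critical layers, truncated at `K`: memo §3.)
* `DressedRayKill`        — THE THEOREM OF THE LINE: an Euler shear orthogonal to `f` with an approximate linear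
                             response kills `FloorClassAtFor β f` for EVERY `β ≤ 3/4` (all `ε₀, C, Θ, ν₀`): the
                             state `a_ν = A ν^{-γ} U + A⁻¹ ν^{γ} b_{K(ν)}` (`γ = 3/8`, `K = ν^{-7/10}`) is quiet,
                             admissible, `ν^{1/2+}`-quasi-steady, and the landed invisible beat harvests the
                             coefficient any multiplier must carry there (memo §2).
* `LinearResponseLemma`   — every trigonometric-polynomial force admits such a shear (frame adapted to `supp f̂`).
* `KolmogorovFloorPoly`   — the crux restricted to trigonometric-polynomial forces;
                             `not_kolmogorovFloorPoly` (PROVED logic): `DressedRayKill → LinearResponseLemma →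
                             ¬ KolmogorovFloorPoly`; `DressedRayLaw` — the full-smooth-force form (memo §5) with
                             `not_kolmogorovFloor_of_law : DressedRayLaw → ¬ KolmogorovFloor` (PROVED logic).
-/

noncomputable section

set_option linter.dupNamespace false

open MeasureTheory UnitAddTorus
open scoped InnerProductSpace ENNReal BigOperators

namespace Summit.AnomalousDissipation.AnomalousDissipation.Cruxes.KolmogorovFloor.Ideator3

open Literature.Analysis.FunctionSpaces Literature.Analysis.FluidPDE
open Summit.AnomalousDissipation.AnomalousDissipation.Theses.TaylorCertificates

local notation "𝕋³" => UnitAddTorus (Fin 3)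
local notation "E³" => EuclideanSpace ℝ (Fin 3)
local notation "L2T" => Lp (EuclideanSpace ℝ (Fin 3)) 2 (volume : Measure (UnitAddTorus (Fin 3)))

/-! ## §A  The crux as a resolution class -/

/-- The band-limited FLOOR clause of resolution exponent `β` for ONE force `f`: verbatim the body of the
route decl `KolmogorovFloor` after its `∃ f, admissible ∧`, with the exponent `3/4` replaced by `β`. -/
def FloorClassAtFor (β : ℝ) (f : 𝕋³ → E³) : Prop :=
  ∃ (ε₀ C Θ ν₀ : ℝ), 0 < ε₀ ∧ 0 < ν₀ ∧ ∀ ν : ℝ, 0 < ν → ν < ν₀ →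
    ∃ (N : ℕ) (Φ₁ : Torus.CylindricalTest (Fin 3)) (θ₁ : ℝ), (N : ℝ) ≤ C * ν ^ (-β) ∧
    (∀ i, Torus.fourierTruncate N (Φ₁.g i) = Φ₁.g i) ∧ -Θ ≤ θ₁ ∧ θ₁ ≤ 0 ∧
    ∀ u : Torus.energySpace (Fin 3),
      let uf : 𝕋³ → E³ := ((u : L2T) : 𝕋³ → E³);
      let D : ℝ := ν * (Torus.eGradNormSq uf).toReal;
      let P : ℝ := Torus.pairing (u : L2T) f - D;
      Torus.eGradNormSq uf ≠ ⊤ → ‖u‖ ^ 2 ≤ 16 * (∫ x, ‖f x‖ ^ 2) / ν ^ 2 →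
      ε₀ ≤ D + Torus.nsGeneratorPairing ν f u (Φ₁.grad u) + 2 * θ₁ * P

/-- The crux is the Kolmogorov class `β = 3/4` for SOME admissible force (definitional). -/
theorem kolmogorovFloor_iff :
    KolmogorovFloor ↔ ∃ f : 𝕋³ → E³, Torus.IsSmooth f ∧ Torus.IsDivFree f ∧ Torus.HasZeroMean f ∧
      FloorClassAtFor (3 / 4) f :=
  Iff.rfl

/-- Monotonicity in the exponent: a certificate class of LOWER resolution is a certificate of higher
resolution (for `ν < 1`, `ν^{-β} ≤ ν^{-β'}` when `β ≤ β'`). Stated; the two-line rpow proof is left to the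
disprover (it is `Real.rpow_le_rpow_of_exponent_ge` on `ν ≤ 1`, after shrinking `ν₀`). -/
def FloorClassMono : Prop :=
  ∀ (β β' : ℝ) (f : 𝕋³ → E³), β ≤ β' → FloorClassAtFor β f → FloorClassAtFor β' f

/-- **Kill shape** for the class `β` and the force `f` (the `∀∃` form of `¬ FloorClassAtFor β f`, in the
quantifier order of the crux: constants first, then a small `ν`, then — AFTER the certificate `(N, Φ₁, θ₁)`
is revealed — a violating finite-enstrophy state of the Leray ball). -/
def FloorKillAtFor (β : ℝ) (f : 𝕋³ → E³) : Prop :=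
  ∀ (ε₀ C Θ ν₀ : ℝ), 0 < ε₀ → 0 < ν₀ → ∃ ν : ℝ, 0 < ν ∧ ν < ν₀ ∧
    ∀ (N : ℕ) (Φ₁ : Torus.CylindricalTest (Fin 3)) (θ₁ : ℝ), (N : ℝ) ≤ C * ν ^ (-β) →
    (∀ i, Torus.fourierTruncate N (Φ₁.g i) = Φ₁.g i) → -Θ ≤ θ₁ → θ₁ ≤ 0 →
    ∃ u : Torus.energySpace (Fin 3),
      let uf : 𝕋³ → E³ := ((u : L2T) : 𝕋³ → E³);
      let D : ℝ := ν * (Torus.eGradNormSq uf).toReal;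
      let P : ℝ := Torus.pairing (u : L2T) f - D;
      Torus.eGradNormSq uf ≠ ⊤ ∧ ‖u‖ ^ 2 ≤ 16 * (∫ x, ‖f x‖ ^ 2) / ν ^ 2 ∧
      D + Torus.nsGeneratorPairing ν f u (Φ₁.grad u) + 2 * θ₁ * P < ε₀

/-- Glue (pure logic), per class and force. -/
theorem not_floorClassAtFor_of_kill {β : ℝ} {f : 𝕋³ → E³} (hK : FloorKillAtFor β f) :
    ¬ FloorClassAtFor β f := by
  rintro ⟨ε₀, C, Θ, ν₀, hε₀, hν₀, h⟩
  obtain ⟨ν, hν, hνν₀, hkill⟩ := hK ε₀ C Θ ν₀ hε₀ hν₀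
  obtain ⟨N, Φ₁, θ₁, hN, hΦ₁, hθ₁, hθ₁', hu⟩ := h ν hν hνν₀
  obtain ⟨u, hfin, hball, hlt⟩ := hkill N Φ₁ θ₁ hN hΦ₁ hθ₁ hθ₁'
  exact absurd (hu u hfin hball) (not_le.mpr hlt)

/-- Glue (pure logic): a Kolmogorov-class kill for every admissible force refutes the crux BY NAME. -/
theorem not_kolmogorovFloor_of_kill
    (hK : ∀ f : 𝕋³ → E³, Torus.IsSmooth f → Torus.IsDivFree f → Torus.HasZeroMean f →
      FloorKillAtFor (3 / 4) f) : ¬ KolmogorovFloor := by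
  rintro ⟨f, hfs, hfd, hfz, hfloor⟩
  exact not_floorClassAtFor_of_kill (hK f hfs hfd hfz) hfloor

/-! ## §B  The skeleton and the first-lemma object -/

/-- A smooth STEADY EULER SHEAR skeleton: a divergence-free, mean-zero trigonometric polynomial `U` with
vanishing self-advection `(U·∇)U = 0` pointwise — e.g. `U = sin(2π ξ·x) ê` with lattice vectors `ξ ⊥ e`
(then also `ΔU = -4π²|ξ|² U`, not recorded). Exact zero of the Euler nonlinearity, viscous drift LINEAR
in the amplitude: the cone of states the dressed ray climbs. -/
structure IsEulerShear (U : 𝕋³ → E³) : Prop where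
  smooth : Torus.IsSmooth U
  divFree : Torus.IsDivFree U
  zeroMean : Torus.HasZeroMean U
  trigPoly : ∃ d : ℕ, Torus.fourierTruncate d U = U
  selfAdvection : ∀ x, Torus.convect U U x = 0

/-- The weighted `ℓ¹` slope `K_w(D) := Σ_{|k| ≤ D} |k| ‖ŵ(k)‖` of a field (finite sum over the frequency
ball; for a trigonometric polynomial of degree `≤ D` it is the quantity `K_a` of ONE-STAGE-PHANTOM §3 /
QUIET-POINT-BEAT §2 that prices the viscous pairing `ν|(∇a, ∇W)| ≤ 4π² ν K_a · max_k |k|‖Ŵ(k)‖`). -/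
def slopeSum (D : ℕ) (w : 𝕋³ → E³) : ℝ :=
  ∑ k ∈ Torus.freqBall D, Real.sqrt (Torus.freqNormSq k) * ‖mFourierCoeff (EuclideanSpace.complexify ∘ w) k‖

/-- `M` bounds the resolved slope of `W`: `|k| ‖Ŵ(k)‖ ≤ M` for every frequency (the quantity the invisible
beat harvests: `Negative.ModesFourier`, ONE-STAGE-PHANTOM §3 Step 2). -/
def SlopeLE (W : 𝕋³ → E³) (M : ℝ) : Prop :=
  ∀ k : Fin 3 → ℤ, Real.sqrt (Torus.freqNormSq k) * ‖mFourierCoeff (EuclideanSpace.complexify ∘ W) k‖ ≤ M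

/-- **FIRST LEMMA object — approximate linear response of the shear `U` to the force `f`.** For every
resolution `K ≥ 1` a solenoidal mean-zero trigonometric polynomial `b_K` of degree `≤ K`, of `K`-uniform
energy, with weighted-ℓ¹ slope and enstrophy `O(K)` (the signature of a LOG-SINGULAR
critical layer: `|b̂(k)| ≍ 1/|k|` along each mode line), solving the LINEARISED STEADY EULER equation
`(U·∇)b + (b·∇)U + ∇q = f` up to a defect of dual size `O(1/K)` against band-limited solenoidal
multipliers (gradients pair to zero with solenoidal `W`, so no pressure appears), and whose self-advection
is `O(log K)` in the same dual norm. Paper construction: memo §3 (inhomogeneous Rayleigh equation at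
`c = 0` per Fourier mode-line, principal value + two delta responses fixed by the `L²`-admissibility of
the spanwise/streamwise components at the critical layers; explicit two-term recurrences in Fourier). -/
def ApproxLinearResponse (f U : 𝕋³ → E³) : Prop :=
  ∃ Cb : ℝ, ∀ K : ℕ, 1 ≤ K → ∃ b : 𝕋³ → E³,
    Torus.IsSmooth b ∧ Torus.IsDivFree b ∧ Torus.HasZeroMean b ∧ Torus.fourierTruncate K b = b ∧
    (∫ x, ‖b x‖ ^ 2) ≤ Cb ∧ slopeSum K b ≤ Cb * K ∧ Torus.gradNormSq b ≤ Cb * K ∧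
    ∀ (D : ℕ) (W : 𝕋³ → E³) (M : ℝ), Torus.IsSmooth W → Torus.IsDivFree W → Torus.HasZeroMean W →
      Torus.fourierTruncate D W = W → SlopeLE W M →
      |∫ x, ⟪Torus.convect U b x + Torus.convect b U x - f x, W x⟫_ℝ| ≤ Cb / K * M ∧
      |∫ x, ⟪Torus.convect b b x, W x⟫_ℝ| ≤ Cb * (1 + Real.log K) * M

/-! ## §C  The theorem of the line and its consequences -/

/-- **DRESSED-RAY KILL** (paper theorem, memo §2; constants explicit). If `f` is a solenoidal mean-zero
trigonometric-polynomial force, `U` an Euler shear skeleton with `(U, f) = 0` carrying an approximate linear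
response to `f`, then EVERY band-limited floor class of exponent `β ≤ 3/4` fails for `f` — in particular the
Kolmogorov class of the crux, for every `ε₀, C, Θ, ν₀`. Witness: `ν` small, then for the revealed certificate
the state `a := A ν^{-γ} U + A⁻¹ ν^{γ} b_K` (`γ = 3/8`, `K = ⌊ν^{-7/10}⌋`; quiet: `ν‖∇a‖² ≍ ν^{1/4}`; far but
inside the Leray ball: `|a|² ≍ ν^{-3/4} ≪ 16‖f‖²/ν²`; work-free: `(a, f) = O(ν^{3/8})`; quasi-steady:
`‖P_N F_ν(a)‖_* = O(ν^{5/8})`) either violates FLOOR itself or forces `max_k |k|‖Φ₁'(a)^(k)‖ ≳ ε₀ ν^{-5/8}`,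
which the coords-invisible two-wave beat (`Negative/ModesFourier`, price `≲ (1+2Θ)(9C² ν^{-1/2} + ν^{-2/5})`
per unit energy) converts into a violation at `a + t w`. -/
def DressedRayKill : Prop :=
  ∀ f U : 𝕋³ → E³, Torus.IsSmooth f → Torus.IsDivFree f → Torus.HasZeroMean f →
    (∃ d : ℕ, Torus.fourierTruncate d f = f) → IsEulerShear U → (∫ x, ⟪U x, f x⟫_ℝ) = 0 →
    ApproxLinearResponse f U → ∀ β : ℝ, β ≤ 3 / 4 → FloorKillAtFor β f

/-- **LINEAR RESPONSE LEMMA** (paper, memo §3; numerics kit j009499): every solenoidal mean-zero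
trigonometric-polynomial force has an Euler shear skeleton `U = sin(2π ξ·x) ê` orthogonal to it (a lattice
frame `ξ ⊥ e` with no mode of `f` on the planes `k·e = 0`, `det(ξ,e,k) = 0`, and non-resonant critical-layer
matrices — automatic for `ξ = e₂`, `e = e₁` when every mode has `k₁ k₃ ≠ 0`) carrying an approximate linear
response. -/
def LinearResponseLemma : Prop :=
  ∀ f : 𝕋³ → E³, Torus.IsSmooth f → Torus.IsDivFree f → Torus.HasZeroMean f →
    (∃ d : ℕ, Torus.fourierTruncate d f = f) →
    ∃ U : 𝕋³ → E³, IsEulerShear U ∧ (∫ x, ⟪U x, f x⟫_ℝ) = 0 ∧ ApproxLinearResponse f U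

/-- The crux restricted to TRIGONOMETRIC-POLYNOMIAL forces (every force the route can "pin": header rev 9,
NOT DECOMPOSED YET — "ONE explicit genuinely three-dimensional trigonometric-polynomial force"). -/
def KolmogorovFloorPoly : Prop :=
  ∃ f : 𝕋³ → E³, Torus.IsSmooth f ∧ Torus.IsDivFree f ∧ Torus.HasZeroMean f ∧
    (∃ d : ℕ, Torus.fourierTruncate d f = f) ∧ FloorClassAtFor (3 / 4) f

/-- A polynomial witness is a witness. -/
theorem kolmogorovFloor_of_poly (h : KolmogorovFloorPoly) : KolmogorovFloor := by
  obtain ⟨f, hfs, hfd, hfz, -, hfloor⟩ := h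
  exact ⟨f, hfs, hfd, hfz, hfloor⟩

/-- **Consequence (logic PROVED): the two statements of the line kill the crux for every polynomial force.** -/
theorem not_kolmogorovFloorPoly (hK : DressedRayKill) (hL : LinearResponseLemma) : ¬ KolmogorovFloorPoly := by
  rintro ⟨f, hfs, hfd, hfz, hpoly, hfloor⟩
  obtain ⟨U, hU, hUf, hLR⟩ := hL f hfs hfd hfz hpoly
  exact not_floorClassAtFor_of_kill (hK f U hfs hfd hfz hpoly hU hUf hLR (3 / 4) le_rfl) hfloor

/-- The same kill for every LOWER class (`β ≤ 3/4`): the Taylor class, the `ν^{-5/8}` class, … all die with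
the Kolmogorov class for polynomial forces (logic PROVED). -/
theorem not_floorClassAtFor_poly (hK : DressedRayKill) (hL : LinearResponseLemma) {β : ℝ} (hβ : β ≤ 3 / 4)
    {f : 𝕋³ → E³} (hfs : Torus.IsSmooth f) (hfd : Torus.IsDivFree f) (hfz : Torus.HasZeroMean f)
    (hpoly : ∃ d : ℕ, Torus.fourierTruncate d f = f) : ¬ FloorClassAtFor β f := by
  obtain ⟨U, hU, hUf, hLR⟩ := hL f hfs hfd hfz hpoly
  exact not_floorClassAtFor_of_kill (hK f U hfs hfd hfz hpoly hU hUf hLR β hβ)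

/-- **DRESSED-RAY LAW** (the full-force form, memo §5: general smooth `f` via `ν`-dependent lattice frames
of size `ν^{-o(1)}` and the `O(ν^{∞})` tail of `f̂` off the frame's resonant planes; needs polynomial
non-resonance bounds — stated as the disprover's target, not claimed proved on paper). -/
def DressedRayLaw : Prop :=
  ∀ f : 𝕋³ → E³, Torus.IsSmooth f → Torus.IsDivFree f → Torus.HasZeroMean f → FloorKillAtFor (3 / 4) f

/-- The law refutes the crux BY NAME (logic PROVED). -/
theorem not_kolmogorovFloor_of_law (h : DressedRayLaw) : ¬ KolmogorovFloor :=
  not_kolmogorovFloor_of_kill h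

end Summit.AnomalousDissipation.AnomalousDissipation.Cruxes.KolmogorovFloor.Ideator3
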